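import Summits.QuantumFields.GaugeBoot.Rows.KZL2HD3HTab
import HarnessLib

/-!
# Gauge-boot: kernel check of the raw `H` class table of the kz-L2-H-3D problems, rows 0–44 (part 1/7)

Cell `pub-gaugeboot` (HOME `run/shared/lean/pub/pub-gaugeboot/`), seat lean1 (torus layer for rows C1–C2 (and C41–C50) = the certified
kz-L2-H-3D windows: label set, raw blocks, class/witness tables, the reduction identity, per-β bindings).

HONEST FRAMING (page 1 of every file of this cell): certified bounds on lattice expectations at STATED coupling,
gauge group, dimension and torus size; NOT a mass gap, NOT a continuum limit, NOT a string tension, NOT large `N`.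
The venture is explicitly NOT Yang–Mills-summit-bearing (barriers `FixedCouplingUltralocality`,
`PerturbativeInvisibility`).

`hcanon_rows_<lo>_<hi> : ∀ i, lo ≤ i < hi → ∀ j ≥ i, KZL2HD3.HCanonOK i j`, each range one closed computation (`decide +kernel`);
assembled in `KZL2HD3Canon`.
-/

noncomputable section

open Literature.MathematicalPhysics.QuantumFieldTheory

namespace Summit.QuantumFields.GaugeBoot

namespace KZL2HD3

set_option maxHeartbeats 0 in
/-- Rows `0 ≤ i < 9` of the `H` class table of the kz-L2-H-3D problems canonicalise (4941 entries; kernel). -/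
theorem hcanon_rows_0_9 : ∀ i : Fin 553, 0 ≤ i.val → i.val < 9 → ∀ j : Fin 553, i.val ≤ j.val → KZL2HD3.HCanonOK i j := by
  decide +kernel

set_option maxHeartbeats 0 in
/-- Rows `9 ≤ i < 18` of the `H` class table of the kz-L2-H-3D problems canonicalise (4860 entries; kernel). -/
theorem hcanon_rows_9_18 : ∀ i : Fin 553, 9 ≤ i.val → i.val < 18 → ∀ j : Fin 553, i.val ≤ j.val → KZL2HD3.HCanonOK i j := by
  decide +kernel

set_option maxHeartbeats 0 in
/-- Rows `18 ≤ i < 27` of the `H` class table of the kz-L2-H-3D problems canonicalise (4779 entries; kernel). -/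
theorem hcanon_rows_18_27 : ∀ i : Fin 553, 18 ≤ i.val → i.val < 27 → ∀ j : Fin 553, i.val ≤ j.val → KZL2HD3.HCanonOK i j := by
  decide +kernel

set_option maxHeartbeats 0 in
/-- Rows `27 ≤ i < 36` of the `H` class table of the kz-L2-H-3D problems canonicalise (4698 entries; kernel). -/
theorem hcanon_rows_27_36 : ∀ i : Fin 553, 27 ≤ i.val → i.val < 36 → ∀ j : Fin 553, i.val ≤ j.val → KZL2HD3.HCanonOK i j := by
  decide +kernel

set_option maxHeartbeats 0 in
/-- Rows `36 ≤ i < 45` of the `H` class table of the kz-L2-H-3D problems canonicalise (4617 entries; kernel). -/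
theorem hcanon_rows_36_45 : ∀ i : Fin 553, 36 ≤ i.val → i.val < 45 → ∀ j : Fin 553, i.val ≤ j.val → KZL2HD3.HCanonOK i j := by
  decide +kernel

end KZL2HD3

end Summit.QuantumFields.GaugeBoot

end
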